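import Mathlib
import HarnessLib
import Literature.AlgebraicGeometry.Ramification.InertiaNormalSylow
import Summits.ResolutionOfSingularities.ResolutionOfSingularities.Theorems.WildQuotientsWildQuotientResolutionPointMoveNpcFinite

/-!
# Inert loci of subgroups: closed, and the non-p-closed ones cover the NPC locus (CARRIER bookkeeping; crux `WildQuotients.WildQuotientResolution`)

Crux stmt-ResolutionOfSingularities-15640 (`WildQuotientResolution`), registered stub
`stub_phaseZeroHighDim`, move-game track. Set-theoretic fixed loci for the CARRIER curves of the
terminating threefold design (memo `PHASE0-DIM3-TERMINATION.md` §2(g), addendum (R4)): for a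
subgroup `K ≤ G` the INERT LOCUS `{x | K ≤ I_x}` (the points fixed by `K` with trivial residue
action — set-theoretically the fixed-point scheme `X^K`) is closed over a separated invariant base
(✓`isClosed_inertiaLocus_of_isSeparated`), lies inside the non-p-closed locus when `K` is not
p-closed, and the non-p-closed locus is the (finite) union of the inert loci of the non-p-closed
subgroups. Carrier curves are components of inert loci of p-closed residuals `R_p(H)`.

* `isClosed_setOf_le_inertia` — `{x | K ≤ I_x}` is closed.
* `setOf_le_inertia_subset_npc` — `K` not p-closed ⇒ `{x | K ≤ I_x} ⊆ NPC`.
* `npc_eq_iUnion_setOf_le_inertia` — `NPC = ⋃_{H ≤ G not p-closed} {x | H ≤ I_x}`.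

[OURS · crux stmt-ResolutionOfSingularities-15640 · helper toward `stub_phaseZeroHighDim`
(threefold Phase 0, carrier bookkeeping); folklore, counted 0; AI-level work, weaker than expert
review.]
-/

-- single-problem summit: the doubled namespace component `ResolutionOfSingularities` is forced
set_option linter.dupNamespace false

namespace Summit.ResolutionOfSingularities.ResolutionOfSingularities.Theorems.WildQuotientResolution.PointMoveNoNpcCurves

open CategoryTheory AlgebraicGeometry TopologicalSpace
open Literature.AlgebraicGeometry.Ramification

/-- **Inert loci are closed**: for an action over a separated invariant base and any subgroup
`K ≤ G`, `{x | K ≤ I_x}` is closed (an intersection of the closed inert loci of the elements of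
`K`). [folklore] -/
theorem isClosed_setOf_le_inertia {X' X₁ : Scheme.{0}} (q : X' ⟶ X₁) [IsSeparated q]
    {G : Type} [Group G] (ρ : G →* Aut X') (hρ : ∀ g : G, (ρ g).hom ≫ q = q) (K : Subgroup G) :
    IsClosed {x : X' | K ≤ inertiaSubgroup ρ x} := by
  have heq : {x : X' | K ≤ inertiaSubgroup ρ x} = ⋂ h ∈ K, {x : X' | h ∈ inertiaSubgroup ρ x} := by
    ext x
    simp only [Set.mem_setOf_eq, Set.mem_iInter]
    rfl
  rw [heq]
  exact isClosed_biInter fun h _ => isClosed_inertiaLocus_of_isSeparated q ρ hρ h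

/-- **The inert locus of a non-p-closed subgroup lies in the non-p-closed locus** (subgroups of
p-closed groups are p-closed). [folklore] -/
theorem setOf_le_inertia_subset_npc {X : Scheme.{0}} {G : Type} [Group G] [Finite G]
    (ρ : G →* Aut X) (p : ℕ) [Fact p.Prime] (K : Subgroup G) (hK : ¬ HasNormalSylow p K) :
    {x : X | K ≤ inertiaSubgroup ρ x} ⊆ {x : X | ¬ HasNormalSylow p (inertiaSubgroup ρ x)} := by
  intro x hx h
  exact hK ((h.subgroup (K.subgroupOf (inertiaSubgroup ρ x))).of_surjective
    (Subgroup.subgroupOfEquivOfLe hx).toMonoidHom (Subgroup.subgroupOfEquivOfLe hx).surjective)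

/-- **The non-p-closed locus is the union of the inert loci of the non-p-closed subgroups.**
[folklore] -/
theorem npc_eq_iUnion_setOf_le_inertia {X : Scheme.{0}} {G : Type} [Group G] [Finite G]
    (ρ : G →* Aut X) (p : ℕ) [Fact p.Prime] :
    {x : X | ¬ HasNormalSylow p (inertiaSubgroup ρ x)} =
      ⋃ K ∈ {K : Subgroup G | ¬ HasNormalSylow p K}, {x : X | K ≤ inertiaSubgroup ρ x} := by
  ext x
  simp only [Set.mem_setOf_eq, Set.mem_iUnion, exists_prop]
  constructor
  · intro hx
    exact ⟨inertiaSubgroup ρ x, hx, le_rfl⟩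
  · rintro ⟨K, hK, hle⟩
    exact setOf_le_inertia_subset_npc ρ p K hK hle

end Summit.ResolutionOfSingularities.ResolutionOfSingularities.Theorems.WildQuotientResolution.PointMoveNoNpcCurves
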